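import Summits.AnomalousDissipation.AnomalousDissipation.Theses.SawtoothPulseCascade
import Summits.AnomalousDissipation.AnomalousDissipation.Theorems.SawtoothPulseCascadeConstructionRegular58
import Summits.AnomalousDissipation.AnomalousDissipation.Theorems.SawtoothPulseCascadeK3LocalisedClosureExistence

/-!
# `SawtoothPulseCascade.Packaging58` (stmt-AnomalousDissipation-19687) — by name

Route `AnomalousDissipation/SawtoothPulseCascade`, rev 11/12 (2026-08-26): first child of the split crux
`K3LocalisedClosure` (`Packaging58 → ApproxSol58 → DriftFreeClosure58 → K3LocalisedClosure`, glue item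
`K3LocalisedClosureGlue`).  The support item `Packaging58` is the conjunction of the two registered packaging
stubs of the lead prover's line `Cruxes.K3LocalisedClosure.DriftFree` (skeleton v3.2), both already theorems
of the tree on the strain box `γ ∈ [5, 8]`, `ρN ∈ {2, …, 7}`:

* `DriftFree.ConstructionRegular` — the lifted datum `(0, 0, sin 2πx₁) ∘ π` is smooth and the lifted force
  `(∂ₜū, 0) ∘ π` is jointly smooth on `[0, 1) × 𝕋³`, `C^α`-bounded and `C^α`-continuous up to `t = 1` for
  every `α < 1`: `Summit.AnomalousDissipation.AnomalousDissipation.Theorems.stub_regularity`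
  (`Theorems/SawtoothPulseCascadeConstructionRegular58.lean`, p445324);
* `DriftFree.Existence` — for every `ν > 0` a global classical planar Navier–Stokes solution from rest forced
  by `∂ₜū`, with its transported scalar from `sin 2πx₁`, the forced weak formulation of the 2½-D lift on
  `[0, 1]` and the cascade scalar (Ladyzhenskaya's 2-D theory):
  `Summit.AnomalousDissipation.AnomalousDissipation.Theorems.SawtoothPulseCascade.DriftFreeExistence.stub_existence`
  (`Theorems/SawtoothPulseCascadeK3LocalisedClosureExistence.lean`, p452816).

This file only records the item under the route's decl so that the ledger credits it.
-/

-- `Summit.<Summit>.<Problem>` is the tree's mandated summit-side namespace (CONVENTIONS §2); for this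
-- single-conjunct summit the two coincide, so the duplicate is deliberate (lakefile: off for `Summits`).
set_option linter.dupNamespace false

namespace Summit.AnomalousDissipation.AnomalousDissipation.Theorems.SawtoothPulseCascade

/-- Closes the route support item `Packaging58` (stmt-AnomalousDissipation-19687, child of the split crux
`K3LocalisedClosure`): `ConstructionRegular ∧ Existence` on the box `γ ∈ [5, 8]`, `ρN ∈ {2, …, 7}` — the pair
of the landed theorems `Theorems.stub_regularity` (p445324) and
`Theorems.SawtoothPulseCascade.DriftFreeExistence.stub_existence` (p452816). -/
theorem packaging58_proof :
    Summit.AnomalousDissipation.AnomalousDissipation.Theses.SawtoothPulseCascade.Packaging58 :=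
  ⟨Summit.AnomalousDissipation.AnomalousDissipation.Theorems.stub_regularity,
   Summit.AnomalousDissipation.AnomalousDissipation.Theorems.SawtoothPulseCascade.DriftFreeExistence.stub_existence⟩

end Summit.AnomalousDissipation.AnomalousDissipation.Theorems.SawtoothPulseCascade
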